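import Literature.Computability.AlgebraicComplexity.LMR13PLambdaStabilizerSplit
import Literature.Computability.AlgebraicComplexity.SkewPairingMatrices
import HarnessLib

/-!
# LMR13 §3.5, stabiliser of `P_Λ`: block (II) — an annihilating `X` maps symmetric matrices to symmetric ones

[topic Computability/AlgebraicComplexity]

Landsberg–Manivel–Ressayre 2013, §3.5 (journal p. 481; arXiv:1004.4802 `p0008.txt:L82–88`) decompose
`End(M_n) = End(Λ²) ⊕ End(S²) ⊕ Hom(Λ²,S²) ⊕ Hom(S²,Λ²)` and assert that the component `ESA ⊂ Hom(S²,Λ²)` is not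
in the stabiliser of `P_Λ` (while its `𝔰𝔩_n`-part … ). In the ANNIHILATOR form used by the tree this is the
statement proved here WITHOUT representation theory (cell val-lit memo `HOME/lmr/X3b-ELEMENTARY-ROUTE-t10g4.md` §3,
"block (II)"): for `X ∈ glAnn (pLambda n)`, `n = h+h+1 ≥ 3` odd, the skew part of `L_X T` vanishes for every
symmetric `T` having a zero row/column (`skewPart_linAct_eq_zero_of_row_eq_zero`), in particular for the basis
`E_ii`, `E_ij + E_ji` of `S²` (`skewPart_linAct_single_add_single_eq_zero`): the `Hom(S²,Λ²)`-block `φ` of an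
annihilating `X` is ZERO. Route: block (II) of `pLambda_glAnn_blocks` (`tr(D(A,φ(S))·S) = 0`), polarised; at the
sparse point `A = R_r(Ω)` (`padAt`) the matrix `D(R_rΩ,φ(S))` vanishes off row/column `r`
(`adjDeriv_padAt_apply_of_ne`), so `tr(D(R_rΩ,φ(S))·T) = 0` when `T` has zero `r`-th row/column, hence by
polarisation `D(R_rΩ,φ(T)) ⟂ S²`, i.e. `D(R_rΩ,φ(T)) = 0` (it is symmetric); then `adj(R_rΩ)·φ(T) = 0` kills row
`r` of `φ(T)` and Jacobi (`adjDeriv_padAt_apply_self`) gives `tr(Ω⁻¹·φ(T)^{(r)}) = 0` for every signed matching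
matrix `Ω = J(π,s)` (`SkewPairingMatrices.lean`), whose pair-differences force `φ(T)^{(r)} = 0`.

Everything is PROVED; theorems only; no named fact. Honest framing: one of the three blocks of (X3b);
`LMR2013_prop_3_5_1` remains OPEN in the tree; VP ≠ VNP is NOT proved and nothing here is progress on it.

## References

* [LandsbergManivelRessayre2013] J. M. Landsberg, L. Manivel, N. Ressayre, *Hypersurfaces with degenerate duals and
  the geometric complexity theory program*, Comment. Math. Helv. 88 (2013) 469–484, §3.5 (p. 481).
-/

noncomputable section

open Matrix

namespace Literature.Computability.AlgebraicComplexity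

namespace SkewAdj

variable {m : ℕ}

/-- `L_X` is additive in its argument. [cite: LandsbergManivelRessayre2013, §3.5 (p. 481)] -/
theorem linAct_add (X : Matrix (Fin m × Fin m) (Fin m × Fin m) ℂ) (S T : Matrix (Fin m) (Fin m) ℂ) :
    (Matrix.of fun k l => ∑ p : Fin m × Fin m, X p (k, l) * (S + T) p.1 p.2) =
      (Matrix.of fun k l => ∑ p : Fin m × Fin m, X p (k, l) * S p.1 p.2) +
        (Matrix.of fun k l => ∑ p : Fin m × Fin m, X p (k, l) * T p.1 p.2) := by
  have h := linAct_add_smul X S T 1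
  rwa [one_smul, one_smul] at h

/-- **Block (II), polarised at a sparse point, against a symmetric matrix with a zero row/column.** For
`X ∈ 𝔤𝔩(W)_{P_Λ}` (`n = m+1` odd), `Ω` invertible skew, `T` symmetric with zero `r`-th row and column:
`D(R_r Ω, (L_X T)_skew) = 0`. [cite: LandsbergManivelRessayre2013, §3.5 (p. 481)] -/
theorem adjDeriv_padAt_skewPart_linAct_eq_zero (hm : Odd (m + 1))
    {X : Matrix (Fin (m + 1) × Fin (m + 1)) (Fin (m + 1) × Fin (m + 1)) ℂ} (hX : X ∈ glAnn (pLambda (m + 1)))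
    (r : Fin (m + 1)) {Ω : Matrix (Fin m) (Fin m) ℂ} (hΩ : Ωᵀ = -Ω) (hΩu : IsUnit Ω.det)
    {T : Matrix (Fin (m + 1)) (Fin (m + 1)) ℂ} (hT : Tᵀ = T) (hTr : ∀ j, T r j = 0) :
    adjDeriv (padAt r Ω) ((1 / 2 : ℂ) •
      ((Matrix.of fun k l => ∑ p : Fin (m + 1) × Fin (m + 1), X p (k, l) * T p.1 p.2) -
        (Matrix.of fun k l => ∑ p : Fin (m + 1) × Fin (m + 1), X p (k, l) * T p.1 p.2)ᵀ)) = 0 := by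
  -- notation
  set R₀ := padAt r Ω with hR₀
  have hR₀skew : R₀ᵀ = -R₀ := by
    rw [hR₀, padAt_transpose, hΩ]
    ext a b
    rcases Fin.eq_self_or_eq_succAbove r a with rfl | ⟨a', rfl⟩
    · simp
    · rcases Fin.eq_self_or_eq_succAbove r b with rfl | ⟨b', rfl⟩
      · simp
      · simp
  have hcard : Odd (Fintype.card (Fin (m + 1))) := by rwa [Fintype.card_fin]
  let φ : Matrix (Fin (m + 1)) (Fin (m + 1)) ℂ → Matrix (Fin (m + 1)) (Fin (m + 1)) ℂ := fun S =>
    (1 / 2 : ℂ) • ((Matrix.of fun k l => ∑ p : Fin (m + 1) × Fin (m + 1), X p (k, l) * S p.1 p.2) -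
      (Matrix.of fun k l => ∑ p : Fin (m + 1) × Fin (m + 1), X p (k, l) * S p.1 p.2)ᵀ)
  have hφskew : ∀ S, (φ S)ᵀ = -φ S := fun S => by
    simp only [φ, Matrix.transpose_smul, Matrix.transpose_sub, Matrix.transpose_transpose, ← smul_neg, neg_sub]
  have hφadd : ∀ S S', φ (S + S') = φ S + φ S' := fun S S' => by
    simp only [φ, linAct_add, Matrix.transpose_add]
    rw [← smul_add]
    congr 1
    abel
  -- block (II): `tr(D(R₀, φ S)·S) = 0` for every symmetric `S`
  have hII : ∀ S : Matrix (Fin (m + 1)) (Fin (m + 1)) ℂ, Sᵀ = S →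
      Matrix.trace (adjDeriv R₀ (φ S) * S) = 0 := fun S hS =>
    (pLambda_glAnn_blocks (Nat.succ_ne_zero m) hX hR₀skew hS).2.2
  -- `tr(D(R₀, φ S)·T) = 0` for every `S`: `D` lives on row/column `r`, where `T` vanishes
  have hTc : ∀ j, T j r = 0 := fun j => by rw [← hT, Matrix.transpose_apply, hTr]
  have hST : ∀ S : Matrix (Fin (m + 1)) (Fin (m + 1)) ℂ, Matrix.trace (adjDeriv R₀ (φ S) * T) = 0 := by
    intro S
    simp only [Matrix.trace, Matrix.diag, Matrix.mul_apply]
    refine Finset.sum_eq_zero fun i _ => Finset.sum_eq_zero fun k _ => ?_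
    by_cases hi : i = r
    · rw [hi, hTc, mul_zero]
    · rcases Fin.eq_self_or_eq_succAbove r k with rfl | ⟨k', rfl⟩
      · rw [hTr, mul_zero]
      · rw [hR₀, adjDeriv_padAt_apply_of_ne hm r hΩ hΩu (hφskew S) hi k', zero_mul]
  -- polarisation: `tr(D(R₀, φ T)·S) = 0` for every symmetric `S`
  have hTS : ∀ S : Matrix (Fin (m + 1)) (Fin (m + 1)) ℂ, Sᵀ = S →
      Matrix.trace (adjDeriv R₀ (φ T) * S) = 0 := by
    intro S hS
    have h1 := hII (S + T) (by rw [Matrix.transpose_add, hS, hT])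
    rw [hφadd, adjDeriv_add, Matrix.add_mul, Matrix.mul_add, Matrix.mul_add, Matrix.trace_add, Matrix.trace_add,
      Matrix.trace_add, hII S hS, hII T hT, hST S] at h1
    simpa using h1
  -- `D(R₀, φ T)` is symmetric and orthogonal to all symmetric matrices, hence zero
  have hDsym : (adjDeriv R₀ (φ T))ᵀ = adjDeriv R₀ (φ T) := adjDeriv_transpose hcard hR₀skew (hφskew T)
  have htr : ∀ (M : Matrix (Fin (m + 1)) (Fin (m + 1)) ℂ) (i j : Fin (m + 1)),
      Matrix.trace (M * Matrix.single i j (1 : ℂ)) = M j i := by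
    intro M i j
    simp only [Matrix.trace, Matrix.diag]
    rw [Fintype.sum_eq_single j (fun a ha => Matrix.mul_single_apply_of_ne (c := (1 : ℂ)) i j a a ha M),
      Matrix.mul_single_apply_same, mul_one]
  ext i j
  have h := hTS (Matrix.single i j (1 : ℂ) + Matrix.single j i (1 : ℂ))
    (by rw [Matrix.transpose_add, Matrix.transpose_single, Matrix.transpose_single]; exact add_comm _ _)
  rw [Matrix.mul_add, Matrix.trace_add, htr, htr] at h
  have hsym : adjDeriv R₀ (φ T) j i = adjDeriv R₀ (φ T) i j := by
    rw [← Matrix.transpose_apply (adjDeriv R₀ (φ T)) i j, hDsym]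
  rw [hsym, ← two_mul, mul_eq_zero] at h
  rw [Matrix.zero_apply]
  exact h.resolve_left two_ne_zero

/-- Sign weights of a fixed-point-free involution: `+1` on the smaller, `−1` on the larger element of each pair.
[cite: LandsbergManivelRessayre2013, §3.5 (p. 481)] -/
theorem signWeight_antisymm {k : ℕ} {π : Equiv.Perm (Fin k)} (hπ : ∀ a, π (π a) = a) (hfix : ∀ a, π a ≠ a)
    (a : Fin k) :
    (fun x : Fin k => if x < π x then (1 : ℂ) else -1) (π a) =
      -(fun x : Fin k => if x < π x then (1 : ℂ) else -1) a := by
  dsimp only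
  rw [hπ]
  rcases lt_or_gt_of_ne (hfix a) with hlt | hgt
  · rw [if_pos hlt, if_neg (not_lt.2 hlt.le), neg_neg]
  · rw [if_neg (not_lt.2 hgt.le), if_pos hgt]

/-- The sign weights do not vanish. [cite: LandsbergManivelRessayre2013, §3.5 (p. 481)] -/
theorem signWeight_ne_zero {k : ℕ} (π : Equiv.Perm (Fin k)) (a : Fin k) :
    (fun x : Fin k => if x < π x then (1 : ℂ) else -1) a ≠ 0 := by
  dsimp only
  split_ifs
  · exact one_ne_zero
  · exact neg_ne_zero.2 one_ne_zero

/-- **Block (II) of the stabiliser computation: an annihilating `X` maps symmetric matrices with a zero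
row/column to SYMMETRIC matrices** — for `X ∈ 𝔤𝔩(W)_{P_Λ}`, `n = h+h+1`, and `T` symmetric with zero `r`-th
row (and column), the skew part of `L_X T` vanishes. Proof: `D(R_rΩ, (L_XT)_skew) = 0` for every signed matching
matrix `Ω = J(π,s)` (`adjDeriv_padAt_skewPart_linAct_eq_zero`); `adj(R_rΩ)·B = 0` kills row `r` of
`B := (L_XT)_skew`, Jacobi gives `tr(Ω⁻¹ B^{(r)}) = 0`, and the pair-differences of the family `J(π,s)` give
`B^{(r)} = 0`. [cite: LandsbergManivelRessayre2013, §3.5 (p. 481)] -/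
theorem skewPart_linAct_eq_zero_of_row_eq_zero {h : ℕ}
    {X : Matrix (Fin (h + h + 1) × Fin (h + h + 1)) (Fin (h + h + 1) × Fin (h + h + 1)) ℂ}
    (hX : X ∈ glAnn (pLambda (h + h + 1))) (r : Fin (h + h + 1))
    {T : Matrix (Fin (h + h + 1)) (Fin (h + h + 1)) ℂ} (hT : Tᵀ = T) (hTr : ∀ j, T r j = 0) :
    (1 / 2 : ℂ) • ((Matrix.of fun k l => ∑ p : Fin (h + h + 1) × Fin (h + h + 1), X p (k, l) * T p.1 p.2) -
      (Matrix.of fun k l => ∑ p : Fin (h + h + 1) × Fin (h + h + 1), X p (k, l) * T p.1 p.2)ᵀ) = 0 := by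
  have hm : Odd (h + h + 1) := ⟨h, by ring⟩
  have hcard : Odd (Fintype.card (Fin (h + h + 1))) := by rwa [Fintype.card_fin]
  set B := (1 / 2 : ℂ) • ((Matrix.of fun k l => ∑ p : Fin (h + h + 1) × Fin (h + h + 1), X p (k, l) * T p.1 p.2) -
      (Matrix.of fun k l => ∑ p : Fin (h + h + 1) × Fin (h + h + 1), X p (k, l) * T p.1 p.2)ᵀ) with hB
  have hBskew : Bᵀ = -B := by
    rw [hB, Matrix.transpose_smul, Matrix.transpose_sub, Matrix.transpose_transpose, ← smul_neg, neg_sub]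
  -- the key facts at a signed matching matrix `Ω = J(π,s)`
  have key : ∀ (π : Equiv.Perm (Fin (h + h))) (s : Fin (h + h) → ℂ), (∀ a, π (π a) = a) →
      (∀ a, s (π a) = -s a) → (∀ a, s a ≠ 0) →
      (∀ j, B r j = 0) ∧ ∑ x, -(s x)⁻¹ * B (r.succAbove (π x)) (r.succAbove x) = 0 := by
    intro π s hπ hs hs0
    have hΩ : (pairMat π s)ᵀ = -pairMat π s := pairMat_transpose hπ hs
    have hΩu : IsUnit (pairMat π s).det := isUnit_det_pairMat hπ hs hs0
    have hD : adjDeriv (padAt r (pairMat π s)) B = 0 :=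
      adjDeriv_padAt_skewPart_linAct_eq_zero hm hX r hΩ hΩu hT hTr
    have hR₀skew : (padAt r (pairMat π s))ᵀ = -padAt r (pairMat π s) := by
      rw [padAt_transpose, hΩ]
      ext a b
      rcases Fin.eq_self_or_eq_succAbove r a with rfl | ⟨a', rfl⟩
      · simp
      · rcases Fin.eq_self_or_eq_succAbove r b with rfl | ⟨b', rfl⟩
        · simp
        · simp
    refine ⟨fun j => ?_, ?_⟩
    · -- row `r`: `adj(R_rΩ)·B = 0`
      have h1 := adjDeriv_mul_eq_neg hcard hR₀skew hBskew
      rw [hD, Matrix.zero_mul, adjugate_padAt, Matrix.smul_mul, eq_comm, neg_eq_zero, smul_eq_zero] at h1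
      rcases h1 with h1 | h1
      · exact absurd h1 hΩu.ne_zero
      · have := congrFun (congrFun h1 r) j
        rwa [Matrix.single_mul_apply_same, one_mul, Matrix.zero_apply] at this
    · -- Jacobi
      have h2 := adjDeriv_padAt_apply_self r hΩu B
      rw [hD, Matrix.zero_apply, eq_comm, mul_eq_zero] at h2
      rcases h2 with h2 | h2
      · exact absurd h2 hΩu.ne_zero
      · rwa [pairMat_inv hπ hs hs0, trace_pairMat_mul] at h2
  -- row and column `r` of `B` vanish (use the half-swap matching with its sign weights)
  have hrow : ∀ j, B r j = 0 :=
    (key (halfSwap h) _ (halfSwap_halfSwap h) (signWeight_antisymm (halfSwap_halfSwap h) (halfSwap_ne h))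
      (signWeight_ne_zero (halfSwap h))).1
  have hcol : ∀ j, B j r = 0 := fun j => by
    have := congrFun (congrFun hBskew r) j
    rw [Matrix.transpose_apply, Matrix.neg_apply, hrow, neg_zero] at this
    exact this
  -- the off-`r` block: pair-differences
  have hoff : ∀ a b : Fin (h + h), a ≠ b → B (r.succAbove b) (r.succAbove a) = 0 := by
    intro a b hab
    obtain ⟨π, hπ, hfix, hπa⟩ := exists_involution_apply_eq hab
    set s : Fin (h + h) → ℂ := fun x => if x < π x then (1 : ℂ) else -1 with hs_def
    have hs : ∀ x, s (π x) = -s x := signWeight_antisymm hπ hfix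
    have hs0 : ∀ x, s x ≠ 0 := signWeight_ne_zero π
    have e1 := (key π s hπ hs hs0).2
    have e2 := (key π (bumpWeight π s a) hπ (bumpWeight_antisymm hπ hs a) (bumpWeight_ne_zero π hs0 a)).2
    have hdiff : ∑ x, (-(bumpWeight π s a x)⁻¹ - -(s x)⁻¹) * B (r.succAbove (π x)) (r.succAbove x) = 0 := by
      simp only [sub_mul, Finset.sum_sub_distrib, e1, e2, sub_zero]
    rw [Finset.sum_eq_add a (π a) (Ne.symm (hfix a))
      (fun x _ hx => by
        unfold bumpWeight
        rw [if_neg (not_or.2 hx), sub_self, zero_mul])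
      (fun hh => absurd (Finset.mem_univ _) hh) (fun hh => absurd (Finset.mem_univ _) hh)] at hdiff
    unfold bumpWeight at hdiff
    rw [if_pos (Or.inl rfl), if_pos (Or.inr rfl), hπ, hs, hπa] at hdiff
    have hBba : B (r.succAbove a) (r.succAbove b) = -B (r.succAbove b) (r.succAbove a) := by
      have := congrFun (congrFun hBskew (r.succAbove a)) (r.succAbove b)
      rw [Matrix.transpose_apply, Matrix.neg_apply] at this
      rw [this, neg_neg]
    rw [hBba] at hdiff
    have hsa : s a ≠ 0 := hs0 a
    have : (s a)⁻¹ * B (r.succAbove b) (r.succAbove a) = 0 := by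
      have e : (-(2 * s a)⁻¹ - -(s a)⁻¹) * B (r.succAbove b) (r.succAbove a) +
          (-(2 * -s a)⁻¹ - -(-s a)⁻¹) * -B (r.succAbove b) (r.succAbove a) =
          (s a)⁻¹ * B (r.succAbove b) (r.succAbove a) := by
        field_simp
        ring
      rw [← e]
      exact hdiff
    simpa [hsa] using this
  -- assemble
  ext i j
  rw [Matrix.zero_apply]
  rcases Fin.eq_self_or_eq_succAbove r i with rfl | ⟨a, rfl⟩
  · exact hrow j
  · rcases Fin.eq_self_or_eq_succAbove r j with rfl | ⟨b, rfl⟩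
    · exact hcol _
    · by_cases hab : b = a
      · subst hab
        have := congrFun (congrFun hBskew (r.succAbove b)) (r.succAbove b)
        rw [Matrix.transpose_apply, Matrix.neg_apply] at this
        have h2 : (2 : ℂ) * B (r.succAbove b) (r.succAbove b) = 0 := by linear_combination this
        exact (mul_eq_zero.1 h2).resolve_left two_ne_zero
      · exact hoff b a hab

/-- **Block (II) on the basis of `S²`**: for `X ∈ 𝔤𝔩(W)_{P_Λ}` (`n = h+h+1 ≥ 3`) and `i, j` with a third index
`r ∉ {i, j}` available, the skew part of `L_X(E_ij + E_ji)` vanishes (take `T = E_ij + E_ji`, whose `r`-th row is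
zero). [cite: LandsbergManivelRessayre2013, §3.5 (p. 481)] -/
theorem skewPart_linAct_single_add_single_eq_zero {h : ℕ}
    {X : Matrix (Fin (h + h + 1) × Fin (h + h + 1)) (Fin (h + h + 1) × Fin (h + h + 1)) ℂ}
    (hX : X ∈ glAnn (pLambda (h + h + 1))) {i j r : Fin (h + h + 1)} (hri : r ≠ i) (hrj : r ≠ j) :
    (1 / 2 : ℂ) • ((Matrix.of fun k l => ∑ p : Fin (h + h + 1) × Fin (h + h + 1),
        X p (k, l) * (Matrix.single i j (1 : ℂ) + Matrix.single j i (1 : ℂ)) p.1 p.2) -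
      (Matrix.of fun k l => ∑ p : Fin (h + h + 1) × Fin (h + h + 1),
        X p (k, l) * (Matrix.single i j (1 : ℂ) + Matrix.single j i (1 : ℂ)) p.1 p.2)ᵀ) = 0 :=
  skewPart_linAct_eq_zero_of_row_eq_zero hX r
    (by rw [Matrix.transpose_add, Matrix.transpose_single, Matrix.transpose_single]; exact add_comm _ _)
    (fun l => by
      rw [Matrix.add_apply, Matrix.single_apply_of_row_ne (Ne.symm hri), Matrix.single_apply_of_row_ne (Ne.symm hrj),
        add_zero])

end SkewAdj

end Literature.Computability.AlgebraicComplexity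

end
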